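import Summits.Ventures.PercRepro.RankLevelSetThroughMinorFive

/-! # RankLevelSetThroughMinorPair — THE 4-CIRCUIT CLASSES OF (★★) ARE THE PAIR FORM OF (↑) ON THE MINOR
`M ／ y ＼ a` (night-1 g40; dossier §52.10; on `RankLevelSetThroughMinorFive`)

For a circuit `K = {y, a, b, c}` through `y`, the MEMBERS of `K` at level `j` (the absorbing `j`-sets whose circuit
with `y` is `K`) are in bijection with the bi-independent `(j − 1)`-sets of the minor `N := M ／ y ＼ a` THROUGH `b`
AND `c` (`Z ↦ Z ∖ {a}`; the circuit swap **`indep_insert_of_four`** replaces `indep_insert_of_triangle`), and the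
TARGETS of `K` at level `j + 1` with the through-`{b, c}` bi-independent `(#E − 2 − j)`-sets of `N`
(`Q ↦ (E ∖ Q) ∖ {a}`) — **`members_four_ncard`**, **`targets_four_ncard`**. The PAIR FORM of (↑)
(**`BiIndepUpPairAt M b c k`**: `#{W ∈ D_k : b, c ∈ W} ≤ #{Z ∈ D_{k+1} : b, c ∉ Z}`; a `Prop`, NOT asserted;
census 0 / 226,990, kits j335512 + mixed.py) says by complementation that the through-`{b,c}` profile is
reflection-increasing across `(#E − 1)/2` (**`upPairAt_iff_through_le_through`**), so the per-circuit inequality of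
(★★) for a 4-circuit at level `j` is EXACTLY the pair (↑) at `{b, c}` and level `j − 1` on the minor
(**`perCircuit_four_iff_upPairAt`**) — the companion of `perCircuit_triangle_iff_upAt`. Every declaration has a
docstring; imports: the cell's own modules and Mathlib only. Axioms: standard. -/

namespace PercRepro

open Set Matroid

variable {α : Type} (M : Matroid α) [M.Finite]

/-! ## The pair form of (↑) -/

omit [M.Finite] in
/-- **The pair form of (↑) at `{b, c}` and level `k`** (night-1 g40; a `Prop`, NOT asserted):
`#{W ∈ D_k : b ∈ W ∧ c ∈ W} ≤ #{Z ∈ D_{k+1} : b ∉ Z ∧ c ∉ Z}`. -/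
def BiIndepUpPairAt (b c : α) (k : ℕ) : Prop :=
  {W ∈ biIndep M k | b ∈ W ∧ c ∈ W}.ncard ≤ {Z ∈ biIndep M (k + 1) | b ∉ Z ∧ c ∉ Z}.ncard

/-- **The avoid-`{b,c}` sets at level `k` are the complements of the through-`{b,c}` sets at level `#E − k`.** -/
lemma avoidPair_ncard_eq_throughPair_compl {b c : α} (hb : b ∈ M.E) (hc : c ∈ M.E) {k : ℕ} (hk : k ≤ M.E.ncard) :
    {Z ∈ biIndep M k | b ∉ Z ∧ c ∉ Z}.ncard = {W ∈ biIndep M (M.E.ncard - k) | b ∈ W ∧ c ∈ W}.ncard := by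
  refine Set.ncard_congr (fun Z _ => M.E \ Z) ?_ ?_ ?_
  · rintro Z ⟨hZ, hbZ, hcZ⟩
    exact ⟨mem_biIndep_compl M hZ, ⟨hb, hbZ⟩, ⟨hc, hcZ⟩⟩
  · rintro Z T ⟨hZ, -⟩ ⟨hT, -⟩ hZT
    have h1 : M.E \ (M.E \ Z) = M.E \ (M.E \ T) := by rw [hZT]
    rwa [Set.sdiff_sdiff_cancel_left hZ.1, Set.sdiff_sdiff_cancel_left hT.1] at h1
  · rintro W ⟨hW, hbW, hcW⟩
    refine ⟨M.E \ W, ⟨?_, fun h => h.2 hbW, fun h => h.2 hcW⟩, Set.sdiff_sdiff_cancel_left hW.1⟩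
    have := mem_biIndep_compl M hW
    rwa [Nat.sub_sub_self hk] at this

/-- **The pair (↑) says that the through-`{b,c}` profile is reflection-increasing across `(#E − 1)/2`.** -/
lemma upPairAt_iff_through_le_through {b c : α} (hb : b ∈ M.E) (hc : c ∈ M.E) {k : ℕ} (hk : k + 1 ≤ M.E.ncard) :
    BiIndepUpPairAt M b c k ↔
      {W ∈ biIndep M k | b ∈ W ∧ c ∈ W}.ncard ≤ {W ∈ biIndep M (M.E.ncard - 1 - k) | b ∈ W ∧ c ∈ W}.ncard := by
  unfold BiIndepUpPairAt
  rw [avoidPair_ncard_eq_throughPair_compl M hb hc hk, show M.E.ncard - (k + 1) = M.E.ncard - 1 - k by omega]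

/-! ## The 4-circuit -/

omit [M.Finite] in
/-- **The circuit swap**: if `{y, a, b, c}` is a circuit, `b, c ∈ W`, `y ∉ W`, `a ∉ W` and `insert y W` is
independent, then `insert a W` is independent (`a ∈ cl W` would put `y ∈ cl {a, b, c} ⊆ cl W`). -/
lemma indep_insert_of_four {y a b c : α} (hK : M.IsCircuit {y, a, b, c}) {W : Set α} (hW : M.Indep (insert y W))
    (hbW : b ∈ W) (hcW : c ∈ W) (hyW : y ∉ W) (haW : a ∉ W) : M.Indep (insert a W) := by
  have hWi : M.Indep W := hW.subset (Set.subset_insert y W)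
  have haE : a ∈ M.E := hK.subset_ground (by simp)
  by_contra h
  rw [hWi.insert_indep_iff_of_notMem haW] at h
  have hacl : a ∈ M.closure W := by
    by_contra h'
    exact h ⟨haE, h'⟩
  have hy : y ∈ M.closure ({y, a, b, c} \ {y}) := hK.mem_closure_sdiff_singleton_of_mem (by simp)
  have hsub : ({y, a, b, c} : Set α) \ {y} ⊆ M.closure W := by
    intro x hx
    rcases hx with ⟨hx, hxy⟩
    simp only [Set.mem_insert_iff, Set.mem_singleton_iff] at hx hxy
    rcases hx with rfl | rfl | rfl | rfl
    · exact absurd rfl hxy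
    · exact hacl
    · exact M.subset_closure W (hWi.subset_ground) hbW
    · exact M.subset_closure W (hWi.subset_ground) hcW
  have hycl : y ∈ M.closure W := by
    have := M.closure_subset_closure hsub hy
    rwa [M.closure_closure] at this
  rw [hWi.insert_indep_iff_of_notMem hyW] at hW
  exact hW.2 hycl

omit [M.Finite] in
/-- **The members of a 4-circuit `{y, a, b, c}` at level `j`** are the bi-independent `j`-sets avoiding `y` and
containing `a`, `b` and `c`. -/
lemma mem_members_four_iff {y a b c : α} (hK : M.IsCircuit {y, a, b, c}) (hya : y ≠ a) (hyb : y ≠ b)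
    (hyc : y ≠ c) {j : ℕ} {Z : Set α} :
    (Z ∈ lowAbsorbAt M y j ∧ M.fundCircuit y Z = {y, a, b, c}) ↔
      (Z ⊆ M.E ∧ Z.ncard = j ∧ M.Indep Z ∧ M.Indep (M.E \ Z) ∧ y ∉ Z ∧ a ∈ Z ∧ b ∈ Z ∧ c ∈ Z) := by
  constructor
  · rintro ⟨⟨⟨hZE, hZj, hZi, hcind⟩, hyZ, -⟩, hfc⟩
    have hsub : ({y, a, b, c} : Set α) ⊆ insert y Z := hfc ▸ M.fundCircuit_subset_insert y Z
    have ha : a ∈ insert y Z := hsub (by simp)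
    have hb : b ∈ insert y Z := hsub (by simp)
    have hc : c ∈ insert y Z := hsub (by simp)
    refine ⟨hZE, hZj, hZi, hcind, hyZ, ?_, ?_, ?_⟩
    · rcases ha with h | h
      · exact absurd h.symm hya
      · exact h
    · rcases hb with h | h
      · exact absurd h.symm hyb
      · exact h
    · rcases hc with h | h
      · exact absurd h.symm hyc
      · exact h
  · rintro ⟨hZE, hZj, hZi, hcind, hyZ, haZ, hbZ, hcZ⟩
    have hsub : ({y, a, b, c} : Set α) ⊆ insert y Z := by
      intro x hx
      simp only [Set.mem_insert_iff, Set.mem_singleton_iff] at hx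
      rcases hx with rfl | rfl | rfl | rfl
      · exact Set.mem_insert _ _
      · exact Set.mem_insert_of_mem _ haZ
      · exact Set.mem_insert_of_mem _ hbZ
      · exact Set.mem_insert_of_mem _ hcZ
    refine ⟨⟨⟨hZE, hZj, hZi, hcind⟩, hyZ, fun hi => hK.dep.not_indep (hi.subset hsub)⟩, ?_⟩
    exact (hK.eq_fundCircuit_of_subset hZi hsub).symm

omit [M.Finite] in
/-- **The targets of a 4-circuit `{y, a, b, c}` at level `j + 1`** are the bi-independent `(j + 1)`-sets containing
`y` and avoiding `a`, `b` and `c`. -/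
lemma mem_targets_four_iff {y a b c : α} (hK : M.IsCircuit {y, a, b, c}) (hya : y ≠ a) (hyb : y ≠ b)
    (hyc : y ≠ c) {j : ℕ} {Q : Set α} :
    (Q ∈ biIndep M (j + 1) ∧ y ∈ Q ∧ ¬ M.Indep (insert y (M.E \ Q)) ∧
        M.fundCircuit y (M.E \ Q) = {y, a, b, c}) ↔
      (Q ⊆ M.E ∧ Q.ncard = j + 1 ∧ M.Indep Q ∧ M.Indep (M.E \ Q) ∧ y ∈ Q ∧ a ∉ Q ∧ b ∉ Q ∧ c ∉ Q) := by
  constructor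
  · rintro ⟨⟨hQE, hQj, hQi, hcind⟩, hyQ, -, hfc⟩
    have hsub : ({y, a, b, c} : Set α) ⊆ insert y (M.E \ Q) := hfc ▸ M.fundCircuit_subset_insert y _
    have ha : a ∈ insert y (M.E \ Q) := hsub (by simp)
    have hb : b ∈ insert y (M.E \ Q) := hsub (by simp)
    have hc : c ∈ insert y (M.E \ Q) := hsub (by simp)
    refine ⟨hQE, hQj, hQi, hcind, hyQ, ?_, ?_, ?_⟩
    · rcases ha with h | h
      · exact absurd h.symm hya
      · exact h.2
    · rcases hb with h | h
      · exact absurd h.symm hyb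
      · exact h.2
    · rcases hc with h | h
      · exact absurd h.symm hyc
      · exact h.2
  · rintro ⟨hQE, hQj, hQi, hcind, hyQ, haQ, hbQ, hcQ⟩
    have haE : a ∈ M.E := hK.subset_ground (by simp)
    have hbE : b ∈ M.E := hK.subset_ground (by simp)
    have hcE : c ∈ M.E := hK.subset_ground (by simp)
    have hsub : ({y, a, b, c} : Set α) ⊆ insert y (M.E \ Q) := by
      intro x hx
      simp only [Set.mem_insert_iff, Set.mem_singleton_iff] at hx
      rcases hx with rfl | rfl | rfl | rfl
      · exact Set.mem_insert _ _
      · exact Set.mem_insert_of_mem _ ⟨haE, haQ⟩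
      · exact Set.mem_insert_of_mem _ ⟨hbE, hbQ⟩
      · exact Set.mem_insert_of_mem _ ⟨hcE, hcQ⟩
    refine ⟨⟨hQE, hQj, hQi, hcind⟩, hyQ, fun hi => hK.dep.not_indep (hi.subset hsub), ?_⟩
    exact (hK.eq_fundCircuit_of_subset hcind hsub).symm

omit [M.Finite] in
/-- A 4-circuit `{y, a, b, c}` has no loops: `y` is a nonloop. -/
lemma isNonloop_of_four {y a b c : α} (hK : M.IsCircuit {y, a, b, c}) (hya : y ≠ a) : M.IsNonloop y := by
  refine Matroid.isNonloop_of_not_isLoop (hK.subset_ground (by simp)) ?_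
  intro hl
  have h := hl.eq_of_isCircuit_mem hK (by simp)
  have ha : a ∈ ({y, a, b, c} : Set α) := by simp
  rw [h, Set.mem_singleton_iff] at ha
  exact hya ha.symm

/-- **THE MEMBERS OF A 4-CIRCUIT ARE THE THROUGH-`{b,c}` BI-INDEPENDENT SETS OF THE MINOR ONE LEVEL DOWN**:
`#{Z ∈ A^y_j : C_y(Z) = {y, a, b, c}} = #{W ∈ D_{j−1}(M ／ y ＼ a) : b, c ∈ W}` (`Z ↦ Z ∖ {a}`). -/
theorem members_four_ncard {y a b c : α} (hK : M.IsCircuit {y, a, b, c}) (hya : y ≠ a) (hyb : y ≠ b)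
    (hyc : y ≠ c) (hab : a ≠ b) (hac : a ≠ c) {j : ℕ} (hj : 1 ≤ j) :
    {Z ∈ lowAbsorbAt M y j | M.fundCircuit y Z = {y, a, b, c}}.ncard =
      {W ∈ biIndep ((M.contract {y}).delete {a}) (j - 1) | b ∈ W ∧ c ∈ W}.ncard := by
  have hynl := isNonloop_of_four M hK hya
  have hyE : y ∈ M.E := hK.subset_ground (by simp)
  have haE : a ∈ M.E := hK.subset_ground (by simp)
  have hground := ground_contract_delete M y a
  refine Set.ncard_congr (fun Z _ => Z \ {a}) ?_ ?_ ?_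
  · intro Z hZ
    rw [Set.mem_setOf_eq] at hZ
    obtain ⟨hZE, hZj, hZi, hcind, hyZ, haZ, hbZ, hcZ⟩ := (mem_members_four_iff M hK hya hyb hyc).mp hZ
    have hsub : ({y, a, b, c} : Set α) ⊆ insert y Z := by
      intro x hx
      simp only [Set.mem_insert_iff, Set.mem_singleton_iff] at hx
      rcases hx with rfl | rfl | rfl | rfl
      · exact Set.mem_insert _ _
      · exact Set.mem_insert_of_mem _ haZ
      · exact Set.mem_insert_of_mem _ hbZ
      · exact Set.mem_insert_of_mem _ hcZ
    have hycl : y ∈ M.closure Z := by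
      by_contra h
      have hi : M.Indep (insert y Z) := (hZi.insert_indep_iff_of_notMem hyZ).mpr ⟨hyE, h⟩
      exact hK.dep.not_indep (hi.subset hsub)
    refine ⟨⟨?_, ?_, ?_, ?_⟩, ⟨hbZ, by simpa using hab.symm⟩, ⟨hcZ, by simpa using hac.symm⟩⟩
    · rw [hground]
      intro x hx
      refine ⟨hZE hx.1, ?_⟩
      simp only [Set.mem_insert_iff, Set.mem_singleton_iff, not_or]
      constructor
      · intro h
        exact hyZ (h ▸ hx.1)
      · simpa using hx.2
    · rw [Set.ncard_sdiff_singleton_of_mem haZ, hZj]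
    · rw [indep_contract_delete_iff_of_isNonloop M hynl]
      refine ⟨⟨fun h => hyZ h.1, by simp⟩, ?_⟩
      have ha : a ∈ M.fundCircuit y Z := by
        rw [hZ.2]
        simp
      rw [hZi.mem_fundCircuit_iff hycl hyZ] at ha
      rwa [Set.insert_sdiff_of_notMem _ (by simpa using hya)] at ha
    · rw [indep_contract_delete_iff_of_isNonloop M hynl, hground]
      have heq : (M.E \ {y, a}) \ (Z \ {a}) = (M.E \ Z) \ {y} := by
        ext x
        simp only [Set.mem_sdiff, Set.mem_insert_iff, Set.mem_singleton_iff, not_or, not_and, not_not]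
        constructor
        · rintro ⟨⟨hxE, hxy, hxa⟩, hx⟩
          exact ⟨⟨hxE, fun hxZ => hxa (hx hxZ)⟩, hxy⟩
        · rintro ⟨⟨hxE, hxZ⟩, hxy⟩
          exact ⟨⟨hxE, hxy, fun hxa => hxZ (hxa ▸ haZ)⟩, fun hxZ' => absurd hxZ' hxZ⟩
      rw [heq]
      constructor
      · constructor
        · simp
        · exact fun h => h.1.2 haZ
      · have hyEZ : y ∈ M.E \ Z := ⟨hyE, hyZ⟩
        rw [Set.insert_sdiff_singleton, Set.insert_eq_of_mem hyEZ]
        exact hcind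
  · intro Z T hZ hT hZT
    rw [Set.mem_setOf_eq] at hZ hT
    have haZ := ((mem_members_four_iff M hK hya hyb hyc).mp hZ).2.2.2.2.2.1
    have haT := ((mem_members_four_iff M hK hya hyb hyc).mp hT).2.2.2.2.2.1
    have h1 : insert a (Z \ {a}) = insert a (T \ {a}) := by rw [hZT]
    rwa [Set.insert_sdiff_self_of_mem haZ, Set.insert_sdiff_self_of_mem haT] at h1
  · rintro W ⟨⟨hWE, hWj, hWi, hWc⟩, hbW, hcW⟩
    rw [hground] at hWE hWc
    have hyW : y ∉ W := fun h => (hWE h).2 (by simp)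
    have haW : a ∉ W := fun h => (hWE h).2 (by simp)
    rw [indep_contract_delete_iff_of_isNonloop M hynl] at hWi hWc
    have hWfin : W.Finite := M.ground_finite.subset (hWE.trans Set.sdiff_subset)
    refine ⟨insert a W, ?_, Set.insert_sdiff_self_of_notMem haW⟩
    rw [Set.mem_setOf_eq, mem_members_four_iff M hK hya hyb hyc]
    refine ⟨Set.insert_subset haE (hWE.trans Set.sdiff_subset), ?_, ?_, ?_, ?_, Set.mem_insert _ _,
      Set.mem_insert_of_mem _ hbW, Set.mem_insert_of_mem _ hcW⟩
    · rw [Set.ncard_insert_of_notMem haW hWfin, hWj]; omega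
    · exact indep_insert_of_four M hK hWi.2 hbW hcW hyW haW
    · have heq : M.E \ insert a W = insert y ((M.E \ {y, a}) \ W) := by
        ext x
        simp only [Set.mem_sdiff, Set.mem_insert_iff, Set.mem_singleton_iff, not_or]
        constructor
        · rintro ⟨hxE, hxa, hxW⟩
          by_cases hxy : x = y
          · exact Or.inl hxy
          · exact Or.inr ⟨⟨hxE, hxy, hxa⟩, hxW⟩
        · rintro (rfl | ⟨⟨hxE, hxy, hxa⟩, hxW⟩)
          · exact ⟨hyE, hya, hyW⟩
          · exact ⟨hxE, hxa, hxW⟩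
      rw [heq]
      exact hWc.2
    · simp only [Set.mem_insert_iff, not_or]
      exact ⟨hya, hyW⟩

/-- **THE TARGETS OF A 4-CIRCUIT ARE THE THROUGH-`{b,c}` BI-INDEPENDENT SETS OF THE MINOR AT LEVEL `#E − 2 − j`**:
`#{Q ∈ D_{j+1} : y ∈ Q, C_y(E ∖ Q) = {y, a, b, c}} = #{W ∈ D_{#E − j − 2}(M ／ y ＼ a) : b, c ∈ W}`
(`Q ↦ (E ∖ Q) ∖ {a}`). -/
theorem targets_four_ncard {y a b c : α} (hK : M.IsCircuit {y, a, b, c}) (hya : y ≠ a) (hyb : y ≠ b)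
    (hyc : y ≠ c) (hab : a ≠ b) (hac : a ≠ c) {j : ℕ} (hj : j + 2 ≤ M.E.ncard) :
    {Q ∈ biIndep M (j + 1) | y ∈ Q ∧ ¬ M.Indep (insert y (M.E \ Q)) ∧
        M.fundCircuit y (M.E \ Q) = {y, a, b, c}}.ncard =
      {W ∈ biIndep ((M.contract {y}).delete {a}) (M.E.ncard - j - 2) | b ∈ W ∧ c ∈ W}.ncard := by
  have hynl := isNonloop_of_four M hK hya
  have hyE : y ∈ M.E := hK.subset_ground (by simp)
  have haE : a ∈ M.E := hK.subset_ground (by simp)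
  have hbE : b ∈ M.E := hK.subset_ground (by simp)
  have hcE : c ∈ M.E := hK.subset_ground (by simp)
  have hground := ground_contract_delete M y a
  refine Set.ncard_congr (fun Q _ => (M.E \ Q) \ {a}) ?_ ?_ ?_
  · intro Q hQ
    rw [Set.mem_setOf_eq] at hQ
    obtain ⟨hQE, hQj, hQi, hcind, hyQ, haQ, hbQ, hcQ⟩ := (mem_targets_four_iff M hK hya hyb hyc).mp hQ
    have hsub : ({y, a, b, c} : Set α) ⊆ insert y (M.E \ Q) := by
      intro x hx
      simp only [Set.mem_insert_iff, Set.mem_singleton_iff] at hx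
      rcases hx with rfl | rfl | rfl | rfl
      · exact Set.mem_insert _ _
      · exact Set.mem_insert_of_mem _ ⟨haE, haQ⟩
      · exact Set.mem_insert_of_mem _ ⟨hbE, hbQ⟩
      · exact Set.mem_insert_of_mem _ ⟨hcE, hcQ⟩
    have hyQ' : y ∉ M.E \ Q := fun h => h.2 hyQ
    have hycl : y ∈ M.closure (M.E \ Q) := by
      by_contra h
      exact hK.dep.not_indep (((hcind.insert_indep_iff_of_notMem hyQ').mpr ⟨hyE, h⟩).subset hsub)
    refine ⟨⟨?_, ?_, ?_, ?_⟩, ⟨⟨hbE, hbQ⟩, by simpa using hab.symm⟩, ⟨⟨hcE, hcQ⟩, by simpa using hac.symm⟩⟩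
    · rw [hground]
      intro x hx
      refine ⟨hx.1.1, ?_⟩
      simp only [Set.mem_insert_iff, Set.mem_singleton_iff, not_or]
      constructor
      · intro h
        exact hx.1.2 (h ▸ hyQ)
      · simpa using hx.2
    · have haEQ : a ∈ M.E \ Q := ⟨haE, haQ⟩
      rw [Set.ncard_sdiff_singleton_of_mem haEQ, Set.ncard_sdiff' hQE M.ground_finite, hQj]
      omega
    · rw [indep_contract_delete_iff_of_isNonloop M hynl]
      refine ⟨⟨fun h => h.1.2 hyQ, by simp⟩, ?_⟩
      have ha : a ∈ M.fundCircuit y (M.E \ Q) := by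
        rw [hQ.2.2.2]
        simp
      rw [hcind.mem_fundCircuit_iff hycl hyQ'] at ha
      rwa [Set.insert_sdiff_of_notMem _ (by simpa using hya)] at ha
    · rw [indep_contract_delete_iff_of_isNonloop M hynl, hground]
      have heq : (M.E \ {y, a}) \ ((M.E \ Q) \ {a}) = Q \ {y} := by
        ext x
        simp only [Set.mem_sdiff, Set.mem_insert_iff, Set.mem_singleton_iff, not_or, not_and, not_not]
        constructor
        · rintro ⟨⟨hxE, hxy, hxa⟩, hx⟩
          refine ⟨?_, hxy⟩
          by_contra hxQ
          exact hxa (hx ⟨hxE, hxQ⟩)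
        · rintro ⟨hxQ, hxy⟩
          exact ⟨⟨hQE hxQ, hxy, fun hxa => haQ (hxa ▸ hxQ)⟩, fun hx => absurd hxQ hx.2⟩
      rw [heq]
      constructor
      · constructor
        · simp
        · exact fun h => haQ h.1
      · rw [Set.insert_sdiff_singleton, Set.insert_eq_of_mem hyQ]
        exact hQi
  · intro Q R hQ hR hQR
    rw [Set.mem_setOf_eq] at hQ hR
    have hQ' := (mem_targets_four_iff M hK hya hyb hyc).mp hQ
    have hR' := (mem_targets_four_iff M hK hya hyb hyc).mp hR
    have haQ : a ∈ M.E \ Q := ⟨haE, hQ'.2.2.2.2.2.1⟩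
    have haR : a ∈ M.E \ R := ⟨haE, hR'.2.2.2.2.2.1⟩
    have h1 : insert a ((M.E \ Q) \ {a}) = insert a ((M.E \ R) \ {a}) := by rw [hQR]
    rw [Set.insert_sdiff_self_of_mem haQ, Set.insert_sdiff_self_of_mem haR] at h1
    have h2 : M.E \ (M.E \ Q) = M.E \ (M.E \ R) := by rw [h1]
    rwa [Set.sdiff_sdiff_cancel_left hQ'.1, Set.sdiff_sdiff_cancel_left hR'.1] at h2
  · rintro W ⟨⟨hWE, hWj, hWi, hWc⟩, hbW, hcW⟩
    rw [hground] at hWE hWc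
    have hyW : y ∉ W := fun h => (hWE h).2 (by simp)
    have haW : a ∉ W := fun h => (hWE h).2 (by simp)
    rw [indep_contract_delete_iff_of_isNonloop M hynl] at hWi hWc
    have hWE' : W ⊆ M.E := hWE.trans Set.sdiff_subset
    have hWfin : W.Finite := M.ground_finite.subset hWE'
    have haWE : insert a W ⊆ M.E := Set.insert_subset haE hWE'
    have hcompl : M.E \ (M.E \ insert a W) = insert a W := Set.sdiff_sdiff_cancel_left haWE
    refine ⟨M.E \ insert a W, ?_, by rw [hcompl, Set.insert_sdiff_self_of_notMem haW]⟩
    rw [Set.mem_setOf_eq, mem_targets_four_iff M hK hya hyb hyc]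
    have heq : M.E \ insert a W = insert y ((M.E \ {y, a}) \ W) := by
      ext x
      simp only [Set.mem_sdiff, Set.mem_insert_iff, Set.mem_singleton_iff, not_or]
      constructor
      · rintro ⟨hxE, hxa, hxW⟩
        by_cases hxy : x = y
        · exact Or.inl hxy
        · exact Or.inr ⟨⟨hxE, hxy, hxa⟩, hxW⟩
      · rintro (rfl | ⟨⟨hxE, hxy, hxa⟩, hxW⟩)
        · exact ⟨hyE, hya, hyW⟩
        · exact ⟨hxE, hxa, hxW⟩
    refine ⟨Set.sdiff_subset, ?_, ?_, ?_, ⟨hyE, by simp only [Set.mem_insert_iff, not_or]; exact ⟨hya, hyW⟩⟩,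
      fun h => h.2 (Set.mem_insert _ _), fun h => h.2 (Set.mem_insert_of_mem _ hbW),
      fun h => h.2 (Set.mem_insert_of_mem _ hcW)⟩
    · rw [Set.ncard_sdiff' haWE M.ground_finite, Set.ncard_insert_of_notMem haW hWfin, hWj]
      omega
    · rw [heq]; exact hWc.2
    · rw [hcompl]
      exact indep_insert_of_four M hK hWi.2 hbW hcW hyW haW

/-- **THE PER-CIRCUIT INEQUALITY OF (★★) FOR A 4-CIRCUIT `{y, a, b, c}` AT LEVEL `j` IS EXACTLY THE PAIR (↑) AT
`{b, c}` AND LEVEL `j − 1` ON THE MINOR `M ／ y ＼ a`** (`1 ≤ j`, `2j + 1 < #E`). -/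
theorem perCircuit_four_iff_upPairAt {y a b c : α} (hK : M.IsCircuit {y, a, b, c}) (hya : y ≠ a) (hyb : y ≠ b)
    (hyc : y ≠ c) (hab : a ≠ b) (hac : a ≠ c) {j : ℕ} (hj : 1 ≤ j) (hn : 2 * j + 1 < M.E.ncard) :
    ({Z ∈ lowAbsorbAt M y j | M.fundCircuit y Z = {y, a, b, c}}.ncard ≤
      {Q ∈ biIndep M (j + 1) | y ∈ Q ∧ ¬ M.Indep (insert y (M.E \ Q)) ∧
        M.fundCircuit y (M.E \ Q) = {y, a, b, c}}.ncard) ↔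
      BiIndepUpPairAt ((M.contract {y}).delete {a}) b c (j - 1) := by
  have hyE : y ∈ M.E := hK.subset_ground (by simp)
  have haE : a ∈ M.E := hK.subset_ground (by simp)
  have hbE : b ∈ M.E := hK.subset_ground (by simp)
  have hcE : c ∈ M.E := hK.subset_ground (by simp)
  haveI := contract_delete_finite M y a
  have hbN : b ∈ ((M.contract {y}).delete {a}).E := by
    rw [ground_contract_delete]
    exact ⟨hbE, by simp only [Set.mem_insert_iff, Set.mem_singleton_iff, not_or]; exact ⟨hyb.symm, hab.symm⟩⟩
  have hcN : c ∈ ((M.contract {y}).delete {a}).E := by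
    rw [ground_contract_delete]
    exact ⟨hcE, by simp only [Set.mem_insert_iff, Set.mem_singleton_iff, not_or]; exact ⟨hyc.symm, hac.symm⟩⟩
  have hcard := ncard_ground_contract_delete' M hyE haE hya
  rw [members_four_ncard M hK hya hyb hyc hab hac hj, targets_four_ncard M hK hya hyb hyc hab hac (by omega),
    upPairAt_iff_through_le_through _ hbN hcN (by rw [hcard]; omega), hcard,
    show M.E.ncard - 2 - 1 - (j - 1) = M.E.ncard - j - 2 by omega]

end PercRepro
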